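import Summits.QuantumFields.BalabanUV.Beta.GAN24.DMBondCharges

/-!
# `BalabanUV.Beta.GAN24.HalfReadout` — row G-an2-4 ∕ (CONV-C), W-slot, SKELETON-W3 §7.2 zero-mode calculus, «W3-S3C*» PART 6 «THE BOND HALF»,
# module (A′): HALF READ-OUTS — ONE outer `K`-leg summed along the coarse lattice against a kernel with summable slices

NOT IN PRINT; OUR BOOKKEEPING (idle-seat kernel lemma, unit `b2b-balaban-gan24-formalise-leaf-06`, gen 9).  HONEST FRAMING (cell contract,
verbatim): «discharging `BetaPertH` makes Bałaban's UV stability UNCONDITIONAL — a real constructive-QFT result; it is NOT the continuum limit and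
NOT the Clay problem.»  HONEST DEPENDENCY (verbatim): «continuum YM on T⁴ ⇐ BetaPertH ∧ nine spine estimates (0/9 proved); BetaPertH ⇐ (D1) ∧ (D4)
∧ CAP+tail; G-an2-4 gates asym, D1 and NE2/3/4.»

WHAT ([folklore]; generic `d`, blocking `N ≥ 1`; 0 `def`, 0 cite, 0 sorry): the one-legged companions of gen 8's two-legged
`ResolventLegCharges.hasSum_sandwich_readout` — for `K` decaying with SITE-FREE coarse-leg charges against a multiplier leg and `V` with
summable slices, **`hasSum_halfReadout_left`**: `HasSum (x′ ↦ (K ∘ V)(N•x′, z)_{(inr α, b)}) (Σ'_y Σ_f ρL f · V y z f b)` and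
**`hasSum_halfReadout_right`**: `HasSum (z′ ↦ (V ∘ K)(x, N•z′)_{(a, inr β)}) (Σ'_y Σ_g V x y a g · ρR g)` (absolute convergence of the
`(inner site, outer coarse leg)` family from the uniform coarse exponential sums; `DMBondCharges.hasSum_fibre_swap`).  Used by modules (B)∕(C)
of PART 6 to push a summed table bond through ONE resolvent leg while the other leg stays attached to a fixed bond.
Asserts NO shape or value of Bałaban's tables; NOT a W3 row; NOT «W-slot closed», NEVER «G-an2-4 closed»; NOT BetaPertH, NOT continuum, NOT Clay.
-/

noncomputable section

open Finset
open scoped BigOperators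
open Literature.MathematicalPhysics.QuantumFieldTheory
open Literature.MathematicalPhysics.QuantumFieldTheory.Balaban1983to89
open Literature.MathematicalPhysics.QuantumFieldTheory.Balaban1983to89.Beta
open B12Sec2to5 (l1 l1_nonneg)
open ExpKernelCalculus (Site MKer Decays comp Zl Zl_nonneg)
open OneStepResolventKernel (Fib)
open Summit.QuantumFields.BalabanUV.Beta.GAN24.KernelLegCharges (summable_exp_coarse)
open Summit.QuantumFields.BalabanUV.Beta.GAN24.ResolventLegCharges (tsum_exp_coarse_le tsum_exp_coarse_le' summable_exp_coarse')
open Summit.QuantumFields.BalabanUV.Beta.GAN24.DMBondCharges (hasSum_fibre_swap)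

namespace Summit.QuantumFields.BalabanUV.Beta.GAN24.HalfReadout

variable {d : ℕ} {N : ℕ} [NeZero N]

/-- [folklore] **LEFT HALF READ-OUT.**  `K` decaying with site-free row charges `ρL f` against `inr α`; `V` with summable first-leg slices at
the second leg `(z, b)`.  Then `HasSum (x′ ↦ (K ∘ V)(N•x′, z)_{(inr α, b)}) (Σ'_y Σ_f ρL f · V y z f b)`. -/
theorem hasSum_halfReadout_left {K V : MKer (d + 1) (Fib d)} {C m : ℝ} (hK : Decays K C m) (hm : 0 < m) (α : Fin (d + 1))
    {ρL : Fib d → ℝ} (hrow : ∀ f y, HasSum (fun x' : Site (d + 1) => K ((N : ℤ) • x') y (Sum.inr α) f) (ρL f))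
    (z : Site (d + 1)) (b : Fib d) (hV : ∀ f, Summable fun y : Site (d + 1) => V y z f b) :
    HasSum (fun x' : Site (d + 1) => comp K V ((N : ℤ) • x') z (Sum.inr α) b)
      (∑' y : Site (d + 1), ∑ f, ρL f * V y z f b) := by
  have hN : 1 ≤ N := Nat.one_le_iff_ne_zero.2 (NeZero.ne N)
  have hC : 0 ≤ C := hK.nonneg (Sum.inl 0)
  -- the envelope of the slices of `V`
  have hB0 : ∀ y : Site (d + 1), 0 ≤ ∑ f, |V y z f b| := fun y => Finset.sum_nonneg fun f _ => abs_nonneg _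
  have hBs : Summable fun y : Site (d + 1) => ∑ f, |V y z f b| := summable_sum fun f _ => (hV f).abs
  -- the double family `(y, x′)` and its majorant
  have hGle : ∀ yx : Site (d + 1) × Site (d + 1), |∑ f, K ((N : ℤ) • yx.2) yx.1 (Sum.inr α) f * V yx.1 z f b|
      ≤ (C * Real.exp (-m * l1 ((N : ℤ) • yx.2 - yx.1))) * ∑ f, |V yx.1 z f b| := by
    intro yx
    rw [Finset.mul_sum]
    refine (Finset.abs_sum_le_sum_abs _ _).trans (Finset.sum_le_sum fun f _ => ?_)
    rw [abs_mul]
    exact mul_le_mul_of_nonneg_right (hK _ _ _ _) (abs_nonneg _)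
  have hM0 : 0 ≤ fun yx : Site (d + 1) × Site (d + 1) => (C * Real.exp (-m * l1 ((N : ℤ) • yx.2 - yx.1))) * ∑ f, |V yx.1 z f b| :=
    fun yx => mul_nonneg (by positivity) (hB0 yx.1)
  have hMfib : ∀ y : Site (d + 1), Summable fun x' : Site (d + 1) =>
      (C * Real.exp (-m * l1 ((N : ℤ) • x' - y))) * ∑ f, |V y z f b| :=
    fun y => ((summable_exp_coarse (d := d) hN hm y).mul_left C).mul_right _
  have hb : ∀ y : Site (d + 1), ∑' x' : Site (d + 1), (C * Real.exp (-m * l1 ((N : ℤ) • x' - y))) * ∑ f, |V y z f b|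
      ≤ (C * (Real.exp (m * ((N : ℝ) * (d + 1))) * Zl (d + 1) m)) * ∑ f, |V y z f b| := by
    intro y
    rw [tsum_mul_right, tsum_mul_left]
    exact mul_le_mul_of_nonneg_right (mul_le_mul_of_nonneg_left (tsum_exp_coarse_le (d := d) N hm y) hC) (hB0 y)
  have hMsum : Summable fun y : Site (d + 1) => ∑' x' : Site (d + 1),
      (C * Real.exp (-m * l1 ((N : ℤ) • x' - y))) * ∑ f, |V y z f b| :=
    Summable.of_nonneg_of_le (fun y => tsum_nonneg fun x' => hM0 (y, x')) hb (hBs.mul_left _)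
  have hmaj : Summable fun yx : Site (d + 1) × Site (d + 1) =>
      (C * Real.exp (-m * l1 ((N : ℤ) • yx.2 - yx.1))) * ∑ f, |V yx.1 z f b| := (summable_prod_of_nonneg hM0).2 ⟨hMfib, hMsum⟩
  have hGs : Summable fun yx : Site (d + 1) × Site (d + 1) => ∑ f, K ((N : ℤ) • yx.2) yx.1 (Sum.inr α) f * V yx.1 z f b :=
    Summable.of_norm_bounded hmaj (fun yx => by rw [Real.norm_eq_abs]; exact hGle yx)
  have hfib : ∀ y : Site (d + 1), HasSum (fun x' : Site (d + 1) => ∑ f, K ((N : ℤ) • x') y (Sum.inr α) f * V y z f b)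
      (∑ f, ρL f * V y z f b) := fun y => hasSum_sum fun f _ => (hrow f y).mul_right (V y z f b)
  have h := hasSum_fibre_swap hGs hfib
  refine h.congr_fun fun x' => ?_
  simp only [comp]

/-- [folklore] **RIGHT HALF READ-OUT.**  `K` decaying with site-free column charges `ρR g` against `inr β`; `V` with summable second-leg slices
at the first leg `(x, a)`.  Then `HasSum (z′ ↦ (V ∘ K)(x, N•z′)_{(a, inr β)}) (Σ'_y Σ_g V x y a g · ρR g)`. -/
theorem hasSum_halfReadout_right {K V : MKer (d + 1) (Fib d)} {C m : ℝ} (hK : Decays K C m) (hm : 0 < m) (β : Fin (d + 1))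
    {ρR : Fib d → ℝ} (hcol : ∀ g w, HasSum (fun z' : Site (d + 1) => K w ((N : ℤ) • z') g (Sum.inr β)) (ρR g))
    (x : Site (d + 1)) (a : Fib d) (hV : ∀ g, Summable fun y : Site (d + 1) => V x y a g) :
    HasSum (fun z' : Site (d + 1) => comp V K x ((N : ℤ) • z') a (Sum.inr β))
      (∑' y : Site (d + 1), ∑ g, V x y a g * ρR g) := by
  have hN : 1 ≤ N := Nat.one_le_iff_ne_zero.2 (NeZero.ne N)
  have hC : 0 ≤ C := hK.nonneg (Sum.inl 0)
  have hB0 : ∀ y : Site (d + 1), 0 ≤ ∑ g, |V x y a g| := fun y => Finset.sum_nonneg fun g _ => abs_nonneg _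
  have hBs : Summable fun y : Site (d + 1) => ∑ g, |V x y a g| := summable_sum fun g _ => (hV g).abs
  have hGle : ∀ yz : Site (d + 1) × Site (d + 1), |∑ g, V x yz.1 a g * K yz.1 ((N : ℤ) • yz.2) g (Sum.inr β)|
      ≤ (∑ g, |V x yz.1 a g|) * (C * Real.exp (-m * l1 (yz.1 - (N : ℤ) • yz.2))) := by
    intro yz
    rw [Finset.sum_mul]
    refine (Finset.abs_sum_le_sum_abs _ _).trans (Finset.sum_le_sum fun g _ => ?_)
    rw [abs_mul]
    exact mul_le_mul_of_nonneg_left (hK _ _ _ _) (abs_nonneg _)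
  have hM0 : 0 ≤ fun yz : Site (d + 1) × Site (d + 1) => (∑ g, |V x yz.1 a g|) * (C * Real.exp (-m * l1 (yz.1 - (N : ℤ) • yz.2))) :=
    fun yz => mul_nonneg (hB0 yz.1) (by positivity)
  have hMfib : ∀ y : Site (d + 1), Summable fun z' : Site (d + 1) =>
      (∑ g, |V x y a g|) * (C * Real.exp (-m * l1 (y - (N : ℤ) • z'))) :=
    fun y => ((summable_exp_coarse' (d := d) hN hm y).mul_left C).mul_left _
  have hb : ∀ y : Site (d + 1), ∑' z' : Site (d + 1), (∑ g, |V x y a g|) * (C * Real.exp (-m * l1 (y - (N : ℤ) • z')))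
      ≤ (∑ g, |V x y a g|) * (C * (Real.exp (m * ((N : ℝ) * (d + 1))) * Zl (d + 1) m)) := by
    intro y
    rw [tsum_mul_left, tsum_mul_left]
    exact mul_le_mul_of_nonneg_left (mul_le_mul_of_nonneg_left (tsum_exp_coarse_le' (d := d) N hm y) hC) (hB0 y)
  have hMsum : Summable fun y : Site (d + 1) => ∑' z' : Site (d + 1),
      (∑ g, |V x y a g|) * (C * Real.exp (-m * l1 (y - (N : ℤ) • z'))) :=
    Summable.of_nonneg_of_le (fun y => tsum_nonneg fun z' => hM0 (y, z')) hb (hBs.mul_right _)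
  have hmaj : Summable fun yz : Site (d + 1) × Site (d + 1) =>
      (∑ g, |V x yz.1 a g|) * (C * Real.exp (-m * l1 (yz.1 - (N : ℤ) • yz.2))) := (summable_prod_of_nonneg hM0).2 ⟨hMfib, hMsum⟩
  have hGs : Summable fun yz : Site (d + 1) × Site (d + 1) => ∑ g, V x yz.1 a g * K yz.1 ((N : ℤ) • yz.2) g (Sum.inr β) :=
    Summable.of_norm_bounded hmaj (fun yz => by rw [Real.norm_eq_abs]; exact hGle yz)
  have hfib : ∀ y : Site (d + 1), HasSum (fun z' : Site (d + 1) => ∑ g, V x y a g * K y ((N : ℤ) • z') g (Sum.inr β))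
      (∑ g, V x y a g * ρR g) := fun y => hasSum_sum fun g _ => (hcol g y).mul_left (V x y a g)
  have h := hasSum_fibre_swap hGs hfib
  refine h.congr_fun fun z' => ?_
  simp only [comp]

end Summit.QuantumFields.BalabanUV.Beta.GAN24.HalfReadout

end
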